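import Summits.QuantumAdvantage.QuantumAdvantage.Theorems.CubicForrelationNearExactIsExactTwelveLevelSixH34Tol
import Summits.QuantumAdvantage.QuantumAdvantage.Theorems.CubicForrelationNearExactIsExactTwelveWildParity
import Summits.QuantumAdvantage.QuantumAdvantage.Theorems.CubicForrelationNearExactIsExactFlatRadical

/-!
# Crux `CubicForrelation.NearExactIsExact` (stmt-QuantumAdvantage-14043) — n = 12 AT `Φ = 29/32`, level-6 configuration (δ₀): PFAFFIAN PARITY and
  the TRANSVERSAL property of the `−3σ`-set inside the 9-flat

Certificate seat `b2b-cforr-cert` (gen 23).  HONEST FRAMING: finite-slice lemmas (standard axioms, no `decide`) about cubic Boolean pairs on 12 bits; the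
level-6 analogue of gen 23's `…TwelveLevelFiveR1TransversalAt2932` (there: odd hyperplane `P`, 128-point set; here: 9-flat `Z`, 32-point set).
NOT summit progress.  Plan: HOME/b2b-cforr-cert-g23/PLAN-N12-928-L6.md.

Setting ((δ₀) of `tw23_boundary_reduction`): cubic `f, g`, `W_g = 64u''`, `Z = {u'' even} = x_Z ⊕ V₀` a 9-flat, `e = u'' − (−1)^f = 0` off `Z`, and on
`Z`: `e ∈ {σ, −3σ}` with `σ = (−1)^{hb}` for some Boolean `hb` (in (δ₀): the mod-4 sign of `e`).  `T = {x ∈ Z : e = −3σ}`.  `B` = the relative alternating form of `hb` at base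
`x_Z` (`fr_hsd`), `Pf` its Pfaffian.
1. (`d0_hsd`) (H3) `4 ∣ Σ_{3-flat} e` (`tw6_H34_tol`) and `e ≡ σ (mod 4)` give base-free second differences of `hb` on `Z`.
2. (`d0_parity`) (H4) `8 ∣ Σ_{4-flat} e` and `Σ σ ≡ 4·Pf (mod 8)` (`ws_sum4_mod8`) give `#{ε : x ⊕ ε·a ∈ T} ≡ Pf(a) (mod 2)`.
3. (`d0_noframe_false`, `d0_frame`) with `#T = 32 < 64 = 2^{9−3}`: a frame with `Pf = 1` exists (`ws_erm_round`).
4. (`d0_transversal`) then every 4-flat `x ⊕ ⟨a⟩`, `x ∈ Z`, meets `T` exactly once (`16·#T = 512 = #Z`).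

References: Ax (1964) / McEliece (1972); MacWilliams–Sloane (1977) Ch. 13 §3, Ch. 15; Carlet (2020) §5.2.  Axioms: the standard three.
-/

set_option linter.dupNamespace false -- D-0017: single-problem summit ⇒ `QuantumAdvantage.QuantumAdvantage` by design

noncomputable section

namespace Summit.QuantumAdvantage.QuantumAdvantage.Theorems.CubicForrelation.NearExactIsExact

open Finset
open Literature.Computability.QuantumComplexity
open Literature.Computability.QuantumComplexity.BuzetChailloux (bxor zeroVec bxor_bxor_cancel_left bxor_zeroVec zeroVec_bxor bxor_comm
  bxor_self)
open Literature.Computability.QuantumComplexity.DerivativeWalsh (W)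

/-! ### 1. Base-free second differences of the mod-4 sign -/

/-- **(H3) for the mod-4 sign.**  In configuration (δ₀), `Σ σ ≡ 0 (mod 4)` over every parametrised 3-flat of `Z`, hence (`fr_hsd`) the second
differences of `hb` on `Z` are base-free. [this work] -/
theorem d0_hsd (f g : (Fin (6 + 6) → Bool) → Bool) (hf : IsDegLeFun 3 f) (hg : IsDegLeFun 3 g)
    (u'' : (Fin (6 + 6) → Bool) → ℤ) (hu'' : ∀ x, W (fun y => signOf (g y)) x = (2 : ℝ) ^ 6 * (u'' x : ℝ))
    (V₀ : Finset (Fin (6 + 6) → Bool)) (xZ : Fin (6 + 6) → Bool) (h0 : zeroVec ∈ V₀) (hadd : ∀ a ∈ V₀, ∀ b ∈ V₀, bxor a b ∈ V₀)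
    (hcardV : #V₀ = 512) (hS : (univ.filter fun x : Fin (6 + 6) → Bool => ¬ Odd (u'' x)) = V₀.image (bxor xZ))
    (hoff0 : ∀ y, y ∉ (univ.filter fun x : Fin (6 + 6) → Bool => ¬ Odd (u'' x)) → (u'' y - sZ (f y)) = 0)
    (hb : (Fin (6 + 6) → Bool) → Bool)
    (hvals : ∀ x ∈ (univ.filter fun x : Fin (6 + 6) → Bool => ¬ Odd (u'' x)), (u'' x - sZ (f x)) = sZ (hb x) ∨ (u'' x - sZ (f x)) = -3 * sZ (hb x)) :
    ∀ x, x ∈ (univ.filter fun x : Fin (6 + 6) → Bool => ¬ Odd (u'' x)) → ∀ p ∈ V₀, ∀ q ∈ V₀, hb (bxor (bxor x p) q) =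
      (hb x ^^ hb (bxor x p) ^^ hb (bxor x q) ^^ (hb xZ ^^ hb (bxor xZ p) ^^ hb (bxor xZ q) ^^ hb (bxor (bxor xZ p) q))) := by
  classical
  have hxZ : xZ ∈ (univ.filter fun x : Fin (6 + 6) → Bool => ¬ Odd (u'' x)) := by rw [hS]; exact mem_image.2 ⟨zeroVec, h0, bxor_zeroVec xZ⟩
  have hPV : ∀ x, x ∈ (univ.filter fun x : Fin (6 + 6) → Bool => ¬ Odd (u'' x)) → ∀ a ∈ V₀, bxor x a ∈ (univ.filter fun x : Fin (6 + 6) → Bool => ¬ Odd (u'' x)) := fun x hx a ha => fl1_coset_vadd hadd hS hx ha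
  have hVP : ∀ x, x ∈ (univ.filter fun x : Fin (6 + 6) → Bool => ¬ Odd (u'' x)) → bxor xZ x ∈ V₀ := fun x hx => fl1_coset_diff hS hx
  have hoff8 : ∀ y, y ∉ (univ.filter fun x : Fin (6 + 6) → Bool => ¬ Odd (u'' x)) → (8 : ℤ) ∣ (u'' y - sZ (f y)) := fun y hy => by rw [hoff0 y hy]; exact dvd_zero 8
  obtain ⟨H3, -⟩ := tw6_H34_tol f g hf hg u'' hu'' V₀ xZ h0 hadd hcardV hS hoff8
  have hmod : ∀ x ∈ (univ.filter fun x : Fin (6 + 6) → Bool => ¬ Odd (u'' x)), ∃ k : ℤ, (u'' x - sZ (f x)) = sZ (hb x) + 4 * k := by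
    intro x hx
    rcases hvals x hx with h | h
    · exact ⟨0, by rw [h]; ring⟩
    · exact ⟨-sZ (hb x), by rw [h]; ring⟩
  have H3σ : ∀ x, x ∈ (univ.filter fun x : Fin (6 + 6) → Bool => ¬ Odd (u'' x)) → ∀ a b c : Fin (6 + 6) → Bool, a ∈ V₀ → b ∈ V₀ → c ∈ V₀ →
      (4 : ℤ) ∣ ∑ ε : Fin 3 → Bool, sZ (hb (fun j => x j ^^ decide (Odd #(univ.filter fun i => ε i && (![a, b, c] : Fin 3 → Fin (6 + 6) → Bool) i j)))) := by
    intro x hx a b c ha hb' hc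
    have hin : ∀ ε : Fin 3 → Bool, (fun j => x j ^^ decide (Odd #(univ.filter fun i => ε i && (![a, b, c] : Fin 3 → Fin (6 + 6) → Bool) i j))) ∈ (univ.filter fun x : Fin (6 + 6) → Bool => ¬ Odd (u'' x)) :=
      fun ε => fr_mem_flatPt3 V₀ h0 (· ∈ (univ.filter fun x : Fin (6 + 6) → Bool => ¬ Odd (u'' x))) hPV hx _ (fun i => by fin_cases i <;> assumption) ε
    have h := H3 x hx a b c ha hb' hc
    have e1 : ∀ ε : Fin 3 → Bool, ∃ k : ℤ, (u'' (fun j => x j ^^ decide (Odd #(univ.filter fun i => ε i && (![a, b, c] : Fin 3 → Fin (6 + 6) → Bool) i j))) - sZ (f (fun j => x j ^^ decide (Odd #(univ.filter fun i => ε i && (![a, b, c] : Fin 3 → Fin (6 + 6) → Bool) i j))))) = sZ (hb (fun j => x j ^^ decide (Odd #(univ.filter fun i => ε i && (![a, b, c] : Fin 3 → Fin (6 + 6) → Bool) i j)))) + 4 * k := fun ε => hmod _ (hin ε)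
    choose k hk using e1
    rw [sum_congr rfl fun ε _ => hk ε, sum_add_distrib, ← mul_sum] at h
    exact (dvd_add_left (Dvd.intro _ rfl)).1 h
  exact fr_hsd V₀ (· ∈ (univ.filter fun x : Fin (6 + 6) → Bool => ¬ Odd (u'' x))) xZ hxZ hVP hb H3σ

/-! ### 2. Pfaffian parity of the 4-flat sections of `T` -/

/-- **Pfaffian parity (level-6 version).**  For `x ∈ Z` and `a₀,…,a₃ ∈ V₀`: `#{ε : x ⊕ ε·a ∈ T}` is even iff `Pf(a₀,…,a₃) = 0`. [this work] -/
theorem d0_parity (f g : (Fin (6 + 6) → Bool) → Bool) (hf : IsDegLeFun 3 f) (hg : IsDegLeFun 3 g)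
    (u'' : (Fin (6 + 6) → Bool) → ℤ) (hu'' : ∀ x, W (fun y => signOf (g y)) x = (2 : ℝ) ^ 6 * (u'' x : ℝ))
    (V₀ : Finset (Fin (6 + 6) → Bool)) (xZ : Fin (6 + 6) → Bool) (h0 : zeroVec ∈ V₀) (hadd : ∀ a ∈ V₀, ∀ b ∈ V₀, bxor a b ∈ V₀)
    (hcardV : #V₀ = 512) (hS : (univ.filter fun x : Fin (6 + 6) → Bool => ¬ Odd (u'' x)) = V₀.image (bxor xZ))
    (hoff0 : ∀ y, y ∉ (univ.filter fun x : Fin (6 + 6) → Bool => ¬ Odd (u'' x)) → (u'' y - sZ (f y)) = 0)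
    (hb : (Fin (6 + 6) → Bool) → Bool)
    (hvals : ∀ x ∈ (univ.filter fun x : Fin (6 + 6) → Bool => ¬ Odd (u'' x)), (u'' x - sZ (f x)) = sZ (hb x) ∨ (u'' x - sZ (f x)) = -3 * sZ (hb x))
    {x a₀ a₁ a₂ a₃ : Fin (6 + 6) → Bool} (hx : x ∈ (univ.filter fun x : Fin (6 + 6) → Bool => ¬ Odd (u'' x))) (ha₀ : a₀ ∈ V₀) (ha₁ : a₁ ∈ V₀) (ha₂ : a₂ ∈ V₀) (ha₃ : a₃ ∈ V₀) :
    Even #(univ.filter fun ε : Fin 4 → Bool => (u'' (fun j => x j ^^ decide (Odd #(univ.filter fun i => ε i && (![a₀, a₁, a₂, a₃] : Fin 4 → Fin (6 + 6) → Bool) i j))) - sZ (f (fun j => x j ^^ decide (Odd #(univ.filter fun i => ε i && (![a₀, a₁, a₂, a₃] : Fin 4 → Fin (6 + 6) → Bool) i j))))) = -3 * sZ (hb (fun j => x j ^^ decide (Odd #(univ.filter fun i => ε i && (![a₀, a₁, a₂, a₃] : Fin 4 → Fin (6 + 6) → Bool) i j))))) ↔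
      ((((hb xZ ^^ hb (bxor xZ a₁) ^^ hb (bxor xZ a₀) ^^ hb (bxor (bxor xZ a₁) a₀)) && (hb xZ ^^ hb (bxor xZ a₃) ^^ hb (bxor xZ a₂) ^^ hb (bxor (bxor xZ a₃) a₂))) ^^ ((hb xZ ^^ hb (bxor xZ a₂) ^^ hb (bxor xZ a₀) ^^ hb (bxor (bxor xZ a₂) a₀)) && (hb xZ ^^ hb (bxor xZ a₃) ^^ hb (bxor xZ a₁) ^^ hb (bxor (bxor xZ a₃) a₁))) ^^ ((hb xZ ^^ hb (bxor xZ a₃) ^^ hb (bxor xZ a₀) ^^ hb (bxor (bxor xZ a₃) a₀)) && (hb xZ ^^ hb (bxor xZ a₂) ^^ hb (bxor xZ a₁) ^^ hb (bxor (bxor xZ a₂) a₁))))) = false := by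
  classical
  set e : (Fin (6 + 6) → Bool) → ℤ := fun x => u'' x - sZ (f x) with hedef
  have hPV : ∀ x, x ∈ (univ.filter fun x : Fin (6 + 6) → Bool => ¬ Odd (u'' x)) → ∀ a ∈ V₀, bxor x a ∈ (univ.filter fun x : Fin (6 + 6) → Bool => ¬ Odd (u'' x)) := fun x hx a ha => fl1_coset_vadd hadd hS hx ha
  have ha : ∀ i, (![a₀, a₁, a₂, a₃] : Fin 4 → Fin (6 + 6) → Bool) i ∈ V₀ := by intro i; fin_cases i <;> assumption
  have hptZ : ∀ ε : Fin 4 → Bool, (fun j => x j ^^ decide (Odd #(univ.filter fun i => ε i && (![a₀, a₁, a₂, a₃] : Fin 4 → Fin (6 + 6) → Bool) i j))) ∈ (univ.filter fun x : Fin (6 + 6) → Bool => ¬ Odd (u'' x)) := fun ε => fr_mem_flatPt4 V₀ h0 (· ∈ (univ.filter fun x : Fin (6 + 6) → Bool => ¬ Odd (u'' x))) hPV hx _ ha ε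
  show Even #(univ.filter fun ε : Fin 4 → Bool => e (fun j => x j ^^ decide (Odd #(univ.filter fun i => ε i && (![a₀, a₁, a₂, a₃] : Fin 4 → Fin (6 + 6) → Bool) i j))) = -3 * sZ (hb (fun j => x j ^^ decide (Odd #(univ.filter fun i => ε i && (![a₀, a₁, a₂, a₃] : Fin 4 → Fin (6 + 6) → Bool) i j))))) ↔ _
  -- (H4): `8 ∣ Σ e` over the flat
  have hoff8 : ∀ y, y ∉ (univ.filter fun x : Fin (6 + 6) → Bool => ¬ Odd (u'' x)) → (8 : ℤ) ∣ (u'' y - sZ (f y)) := fun y hy => by rw [hoff0 y hy]; exact dvd_zero 8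
  obtain ⟨-, H4⟩ := tw6_H34_tol f g hf hg u'' hu'' V₀ xZ h0 hadd hcardV hS hoff8
  have h8 := H4 x hx a₀ a₁ a₂ a₃ ha₀ ha₁ ha₂ ha₃
  change (8 : ℤ) ∣ ∑ ε : Fin 4 → Bool, e (fun j => x j ^^ decide (Odd #(univ.filter fun i => ε i && (![a₀, a₁, a₂, a₃] : Fin 4 → Fin (6 + 6) → Bool) i j))) at h8
  -- `Σ σ ≡ 4·Pf (mod 8)`
  have hsd := d0_hsd f g hf hg u'' hu'' V₀ xZ h0 hadd hcardV hS hoff0 hb hvals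
  have hws := ws_sum4_mod8 V₀ (· ∈ (univ.filter fun x : Fin (6 + 6) → Bool => ¬ Odd (u'' x))) xZ hb hPV hsd hx ha₀ ha₁ ha₂ ha₃
  -- pointwise decomposition `e = σ − 4·[T] + 8·[T ∧ hb]`
  have hdec : ∀ ε : Fin 4 → Bool, e (fun j => x j ^^ decide (Odd #(univ.filter fun i => ε i && (![a₀, a₁, a₂, a₃] : Fin 4 → Fin (6 + 6) → Bool) i j))) = sZ (hb (fun j => x j ^^ decide (Odd #(univ.filter fun i => ε i && (![a₀, a₁, a₂, a₃] : Fin 4 → Fin (6 + 6) → Bool) i j)))) - 4 * (if e (fun j => x j ^^ decide (Odd #(univ.filter fun i => ε i && (![a₀, a₁, a₂, a₃] : Fin 4 → Fin (6 + 6) → Bool) i j))) = -3 * sZ (hb (fun j => x j ^^ decide (Odd #(univ.filter fun i => ε i && (![a₀, a₁, a₂, a₃] : Fin 4 → Fin (6 + 6) → Bool) i j)))) then 1 else 0) +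
      8 * (if e (fun j => x j ^^ decide (Odd #(univ.filter fun i => ε i && (![a₀, a₁, a₂, a₃] : Fin 4 → Fin (6 + 6) → Bool) i j))) = -3 * sZ (hb (fun j => x j ^^ decide (Odd #(univ.filter fun i => ε i && (![a₀, a₁, a₂, a₃] : Fin 4 → Fin (6 + 6) → Bool) i j)))) ∧ hb (fun j => x j ^^ decide (Odd #(univ.filter fun i => ε i && (![a₀, a₁, a₂, a₃] : Fin 4 → Fin (6 + 6) → Bool) i j))) = true then 1 else 0) := by
    intro ε
    have hs : sZ (hb (fun j => x j ^^ decide (Odd #(univ.filter fun i => ε i && (![a₀, a₁, a₂, a₃] : Fin 4 → Fin (6 + 6) → Bool) i j)))) = 1 ∨ sZ (hb (fun j => x j ^^ decide (Odd #(univ.filter fun i => ε i && (![a₀, a₁, a₂, a₃] : Fin 4 → Fin (6 + 6) → Bool) i j)))) = -1 := tp_sZ_cases _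
    rcases hvals _ (hptZ ε) with h | h
    · have h1 : e (fun j => x j ^^ decide (Odd #(univ.filter fun i => ε i && (![a₀, a₁, a₂, a₃] : Fin 4 → Fin (6 + 6) → Bool) i j))) = sZ (hb (fun j => x j ^^ decide (Odd #(univ.filter fun i => ε i && (![a₀, a₁, a₂, a₃] : Fin 4 → Fin (6 + 6) → Bool) i j)))) := h
      have hne : ¬ e (fun j => x j ^^ decide (Odd #(univ.filter fun i => ε i && (![a₀, a₁, a₂, a₃] : Fin 4 → Fin (6 + 6) → Bool) i j))) = -3 * sZ (hb (fun j => x j ^^ decide (Odd #(univ.filter fun i => ε i && (![a₀, a₁, a₂, a₃] : Fin 4 → Fin (6 + 6) → Bool) i j)))) := by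
        intro h'
        rcases hs with hs | hs <;> rw [hs] at h1 h' <;> omega
      rw [if_neg hne, if_neg (fun h' => hne h'.1)]
      omega
    · have heq : e (fun j => x j ^^ decide (Odd #(univ.filter fun i => ε i && (![a₀, a₁, a₂, a₃] : Fin 4 → Fin (6 + 6) → Bool) i j))) = -3 * sZ (hb (fun j => x j ^^ decide (Odd #(univ.filter fun i => ε i && (![a₀, a₁, a₂, a₃] : Fin 4 → Fin (6 + 6) → Bool) i j)))) := h
      rw [if_pos heq]
      by_cases hbt : hb (fun j => x j ^^ decide (Odd #(univ.filter fun i => ε i && (![a₀, a₁, a₂, a₃] : Fin 4 → Fin (6 + 6) → Bool) i j))) = true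
      · rw [if_pos ⟨heq, hbt⟩, heq, hbt]; simp [sZ]
      · rw [if_neg (fun h' => hbt h'.2), heq]
        rw [Bool.not_eq_true] at hbt
        rw [hbt]; simp [sZ]
  have hsum : ∑ ε : Fin 4 → Bool, e (fun j => x j ^^ decide (Odd #(univ.filter fun i => ε i && (![a₀, a₁, a₂, a₃] : Fin 4 → Fin (6 + 6) → Bool) i j))) = ∑ ε : Fin 4 → Bool, sZ (hb (fun j => x j ^^ decide (Odd #(univ.filter fun i => ε i && (![a₀, a₁, a₂, a₃] : Fin 4 → Fin (6 + 6) → Bool) i j)))) -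
      4 * (#(univ.filter fun ε : Fin 4 → Bool => e (fun j => x j ^^ decide (Odd #(univ.filter fun i => ε i && (![a₀, a₁, a₂, a₃] : Fin 4 → Fin (6 + 6) → Bool) i j))) = -3 * sZ (hb (fun j => x j ^^ decide (Odd #(univ.filter fun i => ε i && (![a₀, a₁, a₂, a₃] : Fin 4 → Fin (6 + 6) → Bool) i j))))) : ℤ) +
      8 * ∑ ε : Fin 4 → Bool, (if e (fun j => x j ^^ decide (Odd #(univ.filter fun i => ε i && (![a₀, a₁, a₂, a₃] : Fin 4 → Fin (6 + 6) → Bool) i j))) = -3 * sZ (hb (fun j => x j ^^ decide (Odd #(univ.filter fun i => ε i && (![a₀, a₁, a₂, a₃] : Fin 4 → Fin (6 + 6) → Bool) i j)))) ∧ hb (fun j => x j ^^ decide (Odd #(univ.filter fun i => ε i && (![a₀, a₁, a₂, a₃] : Fin 4 → Fin (6 + 6) → Bool) i j))) = true then (1 : ℤ) else 0) := by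
    rw [sum_congr rfl fun ε _ => hdec ε, sum_add_distrib, sum_sub_distrib, ← mul_sum, ← mul_sum, sum_boole]
  rw [hsum] at h8
  obtain ⟨q, hq⟩ := h8
  rcases Bool.eq_false_or_eq_true ((((hb xZ ^^ hb (bxor xZ a₁) ^^ hb (bxor xZ a₀) ^^ hb (bxor (bxor xZ a₁) a₀)) && (hb xZ ^^ hb (bxor xZ a₃) ^^ hb (bxor xZ a₂) ^^ hb (bxor (bxor xZ a₃) a₂))) ^^ ((hb xZ ^^ hb (bxor xZ a₂) ^^ hb (bxor xZ a₀) ^^ hb (bxor (bxor xZ a₂) a₀)) && (hb xZ ^^ hb (bxor xZ a₃) ^^ hb (bxor xZ a₁) ^^ hb (bxor (bxor xZ a₃) a₁))) ^^ ((hb xZ ^^ hb (bxor xZ a₃) ^^ hb (bxor xZ a₀) ^^ hb (bxor (bxor xZ a₃) a₀)) && (hb xZ ^^ hb (bxor xZ a₂) ^^ hb (bxor xZ a₁) ^^ hb (bxor (bxor xZ a₂) a₁))))) with hPf | hPf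
  · rw [hPf] at hws ⊢
    rw [if_pos rfl] at hws
    refine ⟨fun hE => ?_, fun h => absurd h (by decide)⟩
    obtain ⟨r, hr⟩ := hE
    omega
  · rw [hPf] at hws ⊢
    rw [if_neg (by decide)] at hws
    refine ⟨fun _ => rfl, fun _ => ⟨#(univ.filter fun ε : Fin 4 → Bool => e (fun j => x j ^^ decide (Odd #(univ.filter fun i => ε i && (![a₀, a₁, a₂, a₃] : Fin 4 → Fin (6 + 6) → Bool) i j))) = -3 * sZ (hb (fun j => x j ^^ decide (Odd #(univ.filter fun i => ε i && (![a₀, a₁, a₂, a₃] : Fin 4 → Fin (6 + 6) → Bool) i j))))) / 2, ?_⟩⟩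
    omega

/-! ### 3. A frame with `Pf = 1` exists -/

/-- **No frame ⇒ contradiction** (level-6 version): if `Pf ≡ 0` on `V₀⁴` then `T` has even 4-flat sections in the 9-flat `Z`, so `T = ∅` or
`#T ≥ 64` (`ws_erm_round`), against `#T = 32`. [this work] -/
theorem d0_noframe_false (f g : (Fin (6 + 6) → Bool) → Bool) (hf : IsDegLeFun 3 f) (hg : IsDegLeFun 3 g)
    (u'' : (Fin (6 + 6) → Bool) → ℤ) (hu'' : ∀ x, W (fun y => signOf (g y)) x = (2 : ℝ) ^ 6 * (u'' x : ℝ))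
    (V₀ : Finset (Fin (6 + 6) → Bool)) (xZ : Fin (6 + 6) → Bool) (h0 : zeroVec ∈ V₀) (hadd : ∀ a ∈ V₀, ∀ b ∈ V₀, bxor a b ∈ V₀)
    (hcardV : #V₀ = 512) (hS : (univ.filter fun x : Fin (6 + 6) → Bool => ¬ Odd (u'' x)) = V₀.image (bxor xZ))
    (hoff0 : ∀ y, y ∉ (univ.filter fun x : Fin (6 + 6) → Bool => ¬ Odd (u'' x)) → (u'' y - sZ (f y)) = 0)
    (hb : (Fin (6 + 6) → Bool) → Bool)
    (hvals : ∀ x ∈ (univ.filter fun x : Fin (6 + 6) → Bool => ¬ Odd (u'' x)), (u'' x - sZ (f x)) = sZ (hb x) ∨ (u'' x - sZ (f x)) = -3 * sZ (hb x))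
    (hT : #((univ.filter fun x : Fin (6 + 6) → Bool => ¬ Odd (u'' x)).filter fun x => (u'' x - sZ (f x)) = -3 * sZ (hb x)) = 32)
    (hno : ∀ a₀ ∈ V₀, ∀ a₁ ∈ V₀, ∀ a₂ ∈ V₀, ∀ a₃ ∈ V₀,
      ((((hb xZ ^^ hb (bxor xZ a₁) ^^ hb (bxor xZ a₀) ^^ hb (bxor (bxor xZ a₁) a₀)) && (hb xZ ^^ hb (bxor xZ a₃) ^^ hb (bxor xZ a₂) ^^ hb (bxor (bxor xZ a₃) a₂))) ^^ ((hb xZ ^^ hb (bxor xZ a₂) ^^ hb (bxor xZ a₀) ^^ hb (bxor (bxor xZ a₂) a₀)) && (hb xZ ^^ hb (bxor xZ a₃) ^^ hb (bxor xZ a₁) ^^ hb (bxor (bxor xZ a₃) a₁))) ^^ ((hb xZ ^^ hb (bxor xZ a₃) ^^ hb (bxor xZ a₀) ^^ hb (bxor (bxor xZ a₃) a₀)) && (hb xZ ^^ hb (bxor xZ a₂) ^^ hb (bxor xZ a₁) ^^ hb (bxor (bxor xZ a₂) a₁))))) = false) : False := by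
  classical
  set e : (Fin (6 + 6) → Bool) → ℤ := fun x => u'' x - sZ (f x) with hedef
  have hmemZ : ∀ x, x ∈ V₀.image (bxor xZ) ↔ x ∈ (univ.filter fun x : Fin (6 + 6) → Bool => ¬ Odd (u'' x)) := fun x => by rw [hS]
  have hcardV9 : #V₀ = 2 ^ 9 := by rw [hcardV]; norm_num
  set ψ : (Fin (6 + 6) → Bool) → ℤ := fun z => if e z = -3 * sZ (hb z) then 1 else 0 with hψdef
  have H : ∀ b ∈ V₀.image (bxor xZ), ∀ a : Fin (3 + 1) → Fin (6 + 6) → Bool, (∀ i, a i ∈ V₀) →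
      (2 : ℤ) ∣ ∑ ε : Fin (3 + 1) → Bool, ψ (fun j => b j ^^ decide (Odd #(univ.filter fun i => ε i && a i j))) := by
    intro b hb' a ha
    have ea : a = ![a 0, a 1, a 2, a 3] := by funext i; fin_cases i <;> rfl
    have hE := (d0_parity f g hf hg u'' hu'' V₀ xZ h0 hadd hcardV hS hoff0 hb hvals ((hmemZ b).1 hb') (ha 0) (ha 1) (ha 2) (ha 3)).2
      (hno _ (ha 0) _ (ha 1) _ (ha 2) _ (ha 3))
    rw [← ea] at hE
    have hs : ∑ ε : Fin (3 + 1) → Bool, ψ (fun j => b j ^^ decide (Odd #(univ.filter fun i => ε i && a i j))) =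
        (#(univ.filter fun ε : Fin 4 → Bool => e (fun j => b j ^^ decide (Odd #(univ.filter fun i => ε i && a i j))) = -3 * sZ (hb (fun j => b j ^^ decide (Odd #(univ.filter fun i => ε i && a i j))))) : ℤ) := by
      simp only [ψ]; rw [sum_boole]
    rw [hs]
    exact_mod_cast even_iff_two_dvd.1 hE
  rcases ws_erm_round V₀ h0 hadd hcardV9 xZ ψ 3 H with hall | hbig
  · have hem : ((univ.filter fun x : Fin (6 + 6) → Bool => ¬ Odd (u'' x)).filter fun x => (u'' x - sZ (f x)) = -3 * sZ (hb x)) = ∅ := by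
      refine filter_eq_empty_iff.2 fun z hz hz' => ?_
      have h := hall z ((hmemZ z).2 hz)
      have h1 : ψ z = 1 := by simp only [ψ]; rw [if_pos hz']
      rw [h1] at h
      exact Int.not_even_one h
    rw [hem, card_empty] at hT
    exact absurd hT (by norm_num)
  · have hfe : ((V₀.image (bxor xZ)).filter fun z => Odd (ψ z)) = ((univ.filter fun x : Fin (6 + 6) → Bool => ¬ Odd (u'' x)).filter fun x => (u'' x - sZ (f x)) = -3 * sZ (hb x)) := by
      ext z
      rw [mem_filter, mem_filter, hmemZ]
      constructor
      · rintro ⟨h1, h2⟩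
        refine ⟨h1, ?_⟩
        by_contra hne
        have h0' : ψ z = 0 := by simp only [ψ]; rw [if_neg hne]
        rw [h0'] at h2
        exact (Int.not_odd_iff_even.2 (even_iff_two_dvd.2 (dvd_zero 2))) h2
      · rintro ⟨h1, h2⟩
        refine ⟨h1, ?_⟩
        have h1' : ψ z = 1 := by simp only [ψ]; rw [if_pos h2]
        rw [h1']
        exact odd_one
    rw [hfe, hT] at hbig
    norm_num at hbig

/-- **A frame exists** (level-6 version): periods `a₀,…,a₃ ∈ V₀` with `Pf = 1`. [this work] -/
theorem d0_frame (f g : (Fin (6 + 6) → Bool) → Bool) (hf : IsDegLeFun 3 f) (hg : IsDegLeFun 3 g)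
    (u'' : (Fin (6 + 6) → Bool) → ℤ) (hu'' : ∀ x, W (fun y => signOf (g y)) x = (2 : ℝ) ^ 6 * (u'' x : ℝ))
    (V₀ : Finset (Fin (6 + 6) → Bool)) (xZ : Fin (6 + 6) → Bool) (h0 : zeroVec ∈ V₀) (hadd : ∀ a ∈ V₀, ∀ b ∈ V₀, bxor a b ∈ V₀)
    (hcardV : #V₀ = 512) (hS : (univ.filter fun x : Fin (6 + 6) → Bool => ¬ Odd (u'' x)) = V₀.image (bxor xZ))
    (hoff0 : ∀ y, y ∉ (univ.filter fun x : Fin (6 + 6) → Bool => ¬ Odd (u'' x)) → (u'' y - sZ (f y)) = 0)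
    (hb : (Fin (6 + 6) → Bool) → Bool)
    (hvals : ∀ x ∈ (univ.filter fun x : Fin (6 + 6) → Bool => ¬ Odd (u'' x)), (u'' x - sZ (f x)) = sZ (hb x) ∨ (u'' x - sZ (f x)) = -3 * sZ (hb x))
    (hT : #((univ.filter fun x : Fin (6 + 6) → Bool => ¬ Odd (u'' x)).filter fun x => (u'' x - sZ (f x)) = -3 * sZ (hb x)) = 32) :
    ∃ a₀ ∈ V₀, ∃ a₁ ∈ V₀, ∃ a₂ ∈ V₀, ∃ a₃ ∈ V₀,
      ((((hb xZ ^^ hb (bxor xZ a₁) ^^ hb (bxor xZ a₀) ^^ hb (bxor (bxor xZ a₁) a₀)) && (hb xZ ^^ hb (bxor xZ a₃) ^^ hb (bxor xZ a₂) ^^ hb (bxor (bxor xZ a₃) a₂))) ^^ ((hb xZ ^^ hb (bxor xZ a₂) ^^ hb (bxor xZ a₀) ^^ hb (bxor (bxor xZ a₂) a₀)) && (hb xZ ^^ hb (bxor xZ a₃) ^^ hb (bxor xZ a₁) ^^ hb (bxor (bxor xZ a₃) a₁))) ^^ ((hb xZ ^^ hb (bxor xZ a₃) ^^ hb (bxor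 xZ a₀) ^^ hb (bxor (bxor xZ a₃) a₀)) && (hb xZ ^^ hb (bxor xZ a₂) ^^ hb (bxor xZ a₁) ^^ hb (bxor (bxor xZ a₂) a₁))))) = true := by
  by_contra hne
  push Not at hne
  exact d0_noframe_false f g hf hg u'' hu'' V₀ xZ h0 hadd hcardV hS hoff0 hb hvals hT
    (fun a₀ ha₀ a₁ ha₁ a₂ ha₂ a₃ ha₃ => Bool.eq_false_iff.2 (hne a₀ ha₀ a₁ ha₁ a₂ ha₂ a₃ ha₃))

/-! ### 4. The transversal property -/

/-- **Transversal property** (level-6 version): for a frame with `Pf = 1`, every 4-flat `x ⊕ ⟨a⟩` (`x ∈ Z`) meets `T` in exactly one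
parameter. [this work] -/
theorem d0_transversal (f g : (Fin (6 + 6) → Bool) → Bool) (hf : IsDegLeFun 3 f) (hg : IsDegLeFun 3 g)
    (u'' : (Fin (6 + 6) → Bool) → ℤ) (hu'' : ∀ x, W (fun y => signOf (g y)) x = (2 : ℝ) ^ 6 * (u'' x : ℝ))
    (V₀ : Finset (Fin (6 + 6) → Bool)) (xZ : Fin (6 + 6) → Bool) (h0 : zeroVec ∈ V₀) (hadd : ∀ a ∈ V₀, ∀ b ∈ V₀, bxor a b ∈ V₀)
    (hcardV : #V₀ = 512) (hS : (univ.filter fun x : Fin (6 + 6) → Bool => ¬ Odd (u'' x)) = V₀.image (bxor xZ))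
    (hoff0 : ∀ y, y ∉ (univ.filter fun x : Fin (6 + 6) → Bool => ¬ Odd (u'' x)) → (u'' y - sZ (f y)) = 0)
    (hb : (Fin (6 + 6) → Bool) → Bool)
    (hvals : ∀ x ∈ (univ.filter fun x : Fin (6 + 6) → Bool => ¬ Odd (u'' x)), (u'' x - sZ (f x)) = sZ (hb x) ∨ (u'' x - sZ (f x)) = -3 * sZ (hb x))
    (hT : #((univ.filter fun x : Fin (6 + 6) → Bool => ¬ Odd (u'' x)).filter fun x => (u'' x - sZ (f x)) = -3 * sZ (hb x)) = 32)
    {a₀ a₁ a₂ a₃ : Fin (6 + 6) → Bool} (ha₀ : a₀ ∈ V₀) (ha₁ : a₁ ∈ V₀) (ha₂ : a₂ ∈ V₀) (ha₃ : a₃ ∈ V₀)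
    (hPf : ((((hb xZ ^^ hb (bxor xZ a₁) ^^ hb (bxor xZ a₀) ^^ hb (bxor (bxor xZ a₁) a₀)) && (hb xZ ^^ hb (bxor xZ a₃) ^^ hb (bxor xZ a₂) ^^ hb (bxor (bxor xZ a₃) a₂))) ^^ ((hb xZ ^^ hb (bxor xZ a₂) ^^ hb (bxor xZ a₀) ^^ hb (bxor (bxor xZ a₂) a₀)) && (hb xZ ^^ hb (bxor xZ a₃) ^^ hb (bxor xZ a₁) ^^ hb (bxor (bxor xZ a₃) a₁))) ^^ ((hb xZ ^^ hb (bxor xZ a₃) ^^ hb (bxor xZ a₀) ^^ hb (bxor (bxor xZ a₃) a₀)) && (hb xZ ^^ hb (bxor xZ a₂) ^^ hb (bxor xZ a₁) ^^ hb (bxor (bxor xZ a₂) a₁))))) = true)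
    (x : Fin (6 + 6) → Bool) (hx : x ∈ (univ.filter fun x : Fin (6 + 6) → Bool => ¬ Odd (u'' x))) :
    #(univ.filter fun ε : Fin 4 → Bool => (u'' (fun j => x j ^^ decide (Odd #(univ.filter fun i => ε i && (![a₀, a₁, a₂, a₃] : Fin 4 → Fin (6 + 6) → Bool) i j))) - sZ (f (fun j => x j ^^ decide (Odd #(univ.filter fun i => ε i && (![a₀, a₁, a₂, a₃] : Fin 4 → Fin (6 + 6) → Bool) i j))))) = -3 * sZ (hb (fun j => x j ^^ decide (Odd #(univ.filter fun i => ε i && (![a₀, a₁, a₂, a₃] : Fin 4 → Fin (6 + 6) → Bool) i j))))) = 1 := by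
  classical
  set e : (Fin (6 + 6) → Bool) → ℤ := fun x => u'' x - sZ (f x) with hedef
  have ha : ∀ i, (![a₀, a₁, a₂, a₃] : Fin 4 → Fin (6 + 6) → Bool) i ∈ V₀ := by intro i; fin_cases i <;> assumption
  set Zs := (univ.filter fun x : Fin (6 + 6) → Bool => ¬ Odd (u'' x)) with hZs
  show #(univ.filter fun ε : Fin 4 → Bool => e (fun j => x j ^^ decide (Odd #(univ.filter fun i => ε i && (![a₀, a₁, a₂, a₃] : Fin 4 → Fin (6 + 6) → Bool) i j))) = -3 * sZ (hb (fun j => x j ^^ decide (Odd #(univ.filter fun i => ε i && (![a₀, a₁, a₂, a₃] : Fin 4 → Fin (6 + 6) → Bool) i j))))) = 1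
  have hodd : ∀ z ∈ Zs, Odd #(univ.filter fun ε : Fin 4 → Bool => e (fun j => z j ^^ decide (Odd #(univ.filter fun i => ε i && (![a₀, a₁, a₂, a₃] : Fin 4 → Fin (6 + 6) → Bool) i j))) = -3 * sZ (hb (fun j => z j ^^ decide (Odd #(univ.filter fun i => ε i && (![a₀, a₁, a₂, a₃] : Fin 4 → Fin (6 + 6) → Bool) i j))))) := by
    intro z hz
    have h := d0_parity f g hf hg u'' hu'' V₀ xZ h0 hadd hcardV hS hoff0 hb hvals hz ha₀ ha₁ ha₂ ha₃
    rw [hPf] at h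
    exact Nat.not_even_iff_odd.1 fun hE => absurd (h.1 hE) (by decide)
  have hc : ∀ ε : Fin 4 → Bool, (fun j => zeroVec j ^^ decide (Odd #(univ.filter fun i => ε i && (![a₀, a₁, a₂, a₃] : Fin 4 → Fin (6 + 6) → Bool) i j))) ∈ V₀ :=
    fun ε => ws_flatPt_mem V₀ h0 (fun z => z ∈ V₀) (fun z hz b hb' => hadd z hz b hb') 4 zeroVec h0 _ ha ε
  have hZcard : #Zs = 512 := by
    rw [hS, card_image_of_injective _ (fun y y' hyy => by
      have h' := congrArg (bxor xZ) hyy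
      rwa [bxor_bxor_cancel_left, bxor_bxor_cancel_left] at h'), hcardV]
  have hsum : ∑ z ∈ Zs, #(univ.filter fun ε : Fin 4 → Bool => e (fun j => z j ^^ decide (Odd #(univ.filter fun i => ε i && (![a₀, a₁, a₂, a₃] : Fin 4 → Fin (6 + 6) → Bool) i j))) = -3 * sZ (hb (fun j => z j ^^ decide (Odd #(univ.filter fun i => ε i && (![a₀, a₁, a₂, a₃] : Fin 4 → Fin (6 + 6) → Bool) i j))))) = ∑ z ∈ Zs, 1 := by
    calc ∑ z ∈ Zs, #(univ.filter fun ε : Fin 4 → Bool => e (fun j => z j ^^ decide (Odd #(univ.filter fun i => ε i && (![a₀, a₁, a₂, a₃] : Fin 4 → Fin (6 + 6) → Bool) i j))) = -3 * sZ (hb (fun j => z j ^^ decide (Odd #(univ.filter fun i => ε i && (![a₀, a₁, a₂, a₃] : Fin 4 → Fin (6 + 6) → Bool) i j)))))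
        = ∑ z ∈ Zs, ∑ ε : Fin 4 → Bool, (if e (fun j => z j ^^ decide (Odd #(univ.filter fun i => ε i && (![a₀, a₁, a₂, a₃] : Fin 4 → Fin (6 + 6) → Bool) i j))) = -3 * sZ (hb (fun j => z j ^^ decide (Odd #(univ.filter fun i => ε i && (![a₀, a₁, a₂, a₃] : Fin 4 → Fin (6 + 6) → Bool) i j)))) then 1 else 0) :=
          sum_congr rfl fun z _ => by rw [sum_boole, Nat.cast_id]
      _ = ∑ ε : Fin 4 → Bool, ∑ z ∈ Zs, (if e (fun j => z j ^^ decide (Odd #(univ.filter fun i => ε i && (![a₀, a₁, a₂, a₃] : Fin 4 → Fin (6 + 6) → Bool) i j))) = -3 * sZ (hb (fun j => z j ^^ decide (Odd #(univ.filter fun i => ε i && (![a₀, a₁, a₂, a₃] : Fin 4 → Fin (6 + 6) → Bool) i j)))) then 1 else 0) := sum_comm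
      _ = ∑ ε : Fin 4 → Bool, #(Zs.filter fun z => e (bxor z (fun j => zeroVec j ^^ decide (Odd #(univ.filter fun i => ε i && (![a₀, a₁, a₂, a₃] : Fin 4 → Fin (6 + 6) → Bool) i j)))) = -3 * sZ (hb (bxor z (fun j => zeroVec j ^^ decide (Odd #(univ.filter fun i => ε i && (![a₀, a₁, a₂, a₃] : Fin 4 → Fin (6 + 6) → Bool) i j)))))) := by
          refine sum_congr rfl fun ε _ => ?_
          rw [sum_boole, Nat.cast_id]
          exact congrArg card (filter_congr fun z _ => by rw [ws_flatPt_eq_bxor z _ ε])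
      _ = ∑ ε : Fin 4 → Bool, #(Zs.filter fun z => e z = -3 * sZ (hb z)) :=
          sum_congr rfl fun ε _ => ws_card_translate V₀ Zs xZ hadd hS (hc ε) (fun z => e z = -3 * sZ (hb z))
      _ = ∑ ε : Fin 4 → Bool, 32 := by
          refine sum_congr rfl fun ε _ => ?_
          rw [← hT]
      _ = ∑ z ∈ Zs, 1 := by
          rw [sum_const, sum_const, smul_eq_mul, smul_eq_mul, card_univ, Fintype.card_fun, Fintype.card_bool,
            Fintype.card_fin, hZcard]
          norm_num
  have hle : ∀ z ∈ Zs, 1 ≤ #(univ.filter fun ε : Fin 4 → Bool => e (fun j => z j ^^ decide (Odd #(univ.filter fun i => ε i && (![a₀, a₁, a₂, a₃] : Fin 4 → Fin (6 + 6) → Bool) i j))) = -3 * sZ (hb (fun j => z j ^^ decide (Odd #(univ.filter fun i => ε i && (![a₀, a₁, a₂, a₃] : Fin 4 → Fin (6 + 6) → Bool) i j))))) := by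
    intro z hz
    rcases hodd z hz with ⟨r, hr⟩
    omega
  have hall := (sum_eq_sum_iff_of_le hle).1 hsum.symm
  exact (hall x hx).symm

end Summit.QuantumAdvantage.QuantumAdvantage.Theorems.CubicForrelation.NearExactIsExact

end
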